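import Summits.QuantumFields.YangMills.Theorems.FradkinShenkerFlowSusceptibilityToPoincareOneLevelLaw
import Summits.QuantumFields.YangMills.Theorems.FradkinShenkerFlowSusceptibilityToPoincareProductVariance
import Summits.QuantumFields.YangMills.Theorems.FradkinShenkerFlowSusceptibilityToPoincareHeatBathSensitivity
import Summits.QuantumFields.YangMills.Theorems.FradkinShenkerFlowSusceptibilityToPoincareTiltedShift
import Summits.QuantumFields.YangMills.Theorems.FradkinShenkerFlowSusceptibilityToPoincareStraightPathUnique

/-!
# Riders `heatBathSensitivity_le` (OLb) and `oneLevel_variance_le` (OL) of the line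
`rg-variance-cascade` (crux `SusceptibilityToPoincare`) — the ONE-LEVEL NECESSITY INEQUALITY

Route `FradkinShenkerFlow` of `YangMills`, crux item `stmt-QuantumFields-9441`
(`Summit.QuantumFields.YangMills.Theses.FradkinShenkerFlow.SusceptibilityToPoincare`, FS ⇒ UP),
registered skeleton `Cruxes/SusceptibilityToPoincare/Lines/rg_variance_cascade.lean`; lead c3, cycle 2:
the NECESSITY PACKAGE "UP ⇒ (stub D's terminal inequality)".  This file glues the landed riders
N1 `stub_oneLevelLaw_eq_map`, N3 `stub_straightPath_unique`, N4 `stub_productVariance_le`,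
N5 `stub_tiltedShift_sq_le` and G1b `stub_heatBathSensitivity_of` into:

* `heatBathSensitivity_le` (OLb): G1b with its two hypotheses discharged by N5 and N3;
* `oneLevel_variance_le` (OL): **if the Wilson measure `μ = μ_{β,S}` satisfies the uniform heat-bath
  Poincaré inequality with constant `C` (UP), then for the one-level joint law `P` of the fine field
  and its von Mises–Fisher-smeared block field at block size `B` and pin strength `s`, EVERY bounded
  measurable `g` of the block field and EVERY family of bounded measurable approximants `c_e` blind to
  the coordinate `e` satisfy `∫ (g(V) − ∫ g dP)² dP ≤ K Σ_e ∫ (g(V) − c_e(V))² dP` with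
  `K = 4 + 2|C|·|K'|`, `K' = 4 e^{4|s|B_ρ} B` — S-free.**

## Proof of OL

By N1, `P = (μ ⊗ π).map Ψ` with `π = ν^{⊗E}` (`ν` the vMF one-link law) and the unshear
`Ψ(U, w) = (U, e ↦ w_e · h_e(U))`.  With `H(U) = ∫ g(w·h(U)) dπ(w)` and `m = ∫ g dP = ∫ H dμ`:
`(g − m)² ≤ 2 (g − H)² + 2 (H − m)²`; the first term is, fibrewise in `U`, a variance under the
PRODUCT measure `π`, bounded by `2·2 Σ_e ∫ (g − c_e)² dπ` by the Efron–Stein inequality with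
coordinate-free approximants (N4); the second is `Var_μ(H) ≤ |C| · HB(H)` by UP applied to the
bounded measurable `H`, and `HB(H) ≤ K' Σ_e ∫∫ (g − c_e)² dπ dμ` by OLb.  Fubini turns
`∫∫ (g − c_e)² dπ dμ` back into `∫ (g − c_e)² dP` (`OneLevelNecessity.integral_sq_sub_le_of_split`,
the abstract core).
-/

noncomputable section

open MeasureTheory ProbabilityTheory
open Literature.MathematicalPhysics.QuantumFieldTheory

namespace Summit.QuantumFields.YangMills.Theorems.SusceptibilityToPoincare.RgVarianceCascade

namespace OneLevelNecessity

/-! ### Abstract core: variance split along the first factor of a sheared product -/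

section Abstract

variable {X Y : Type*} [MeasurableSpace X] [MeasurableSpace Y]

/-- A measurable function bounded in absolute value is integrable for a finite measure. [folklore] -/
theorem integrable_of_abs_le {α : Type*} [MeasurableSpace α] {ν : Measure α} [IsFiniteMeasure ν]
    {f : α → ℝ} (hf : Measurable f) {M : ℝ} (hM : ∀ x, |f x| ≤ M) : Integrable f ν :=
  Integrable.of_bound hf.aestronglyMeasurable M
    (ae_of_all _ fun x => by simpa only [Real.norm_eq_abs] using hM x)

/-- The integral of a function bounded by `M` in absolute value against a probability measure is
bounded by `M` in absolute value. [folklore] -/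
theorem abs_integral_le_of_abs_le {α : Type*} [MeasurableSpace α] {ν : Measure α}
    [IsProbabilityMeasure ν] {f : α → ℝ} {M : ℝ} (hM : ∀ x, |f x| ≤ M) : |∫ x, f x ∂ν| ≤ M := by
  have := norm_integral_le_of_norm_le_const (μ := ν) (C := M) (f := f)
    (ae_of_all _ fun x => by simpa only [Real.norm_eq_abs] using hM x)
  simpa only [Real.norm_eq_abs, probReal_univ, mul_one] using this

/-- `|a − b| ≤ M + N` when `|a| ≤ M`, `|b| ≤ N`, hence `(a − b)²` is bounded by `(M + N)²` in
absolute value. [folklore] -/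
theorem abs_sq_sub_le {a b M N : ℝ} (ha : |a| ≤ M) (hb : |b| ≤ N) :
    |(a - b) ^ 2| ≤ (M + N) ^ 2 := by
  rw [abs_of_nonneg (sq_nonneg _), ← sq_abs (a - b)]
  exact pow_le_pow_left₀ (abs_nonneg _) ((abs_sub a b).trans (add_le_add ha hb)) 2

/-- `(a − b)² ≤ 2 (a − c)² + 2 (c − b)²`: the difference of the two sides is `(a + b − 2c)²`.
[folklore] -/
theorem sq_sub_le_two_mul_add' (a b c : ℝ) :
    (a - b) ^ 2 ≤ 2 * (a - c) ^ 2 + 2 * (c - b) ^ 2 := by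
  nlinarith [sq_nonneg (a + b - 2 * c)]

/-- **Variance split along the first factor of a sheared product** (abstract core of OL).  Let
`μ`, `π` be probability measures on `X`, `Y`, `unsh : X × Y → Y` measurable, `P` the image of
`μ ⊗ π` under `Ψ(x, y) = (x, unsh(x, y))`, `g : Y → ℝ` bounded measurable, `c_e : Y → ℝ`
bounded measurable (`e` in a finite type), `H x = ∫ g(unsh(x, ·)) dπ`,
`R_e x = ∫ (g − c_e)²(unsh(x, ·)) dπ`.  If fibrewise `∫ (g(unsh(x,·)) − H x)² dπ ≤ 2 Σ_e R_e x`
(Efron–Stein) and `∫ (H − ∫H dμ)² dμ ≤ A Σ_e ∫ R_e dμ`, then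
`∫ (g∘snd − ∫ g∘snd dP)² dP ≤ (4 + 2A) Σ_e ∫ (g − c_e)²∘snd dP`
(`(g − m)² ≤ 2(g − H)² + 2(H − m)²`, `m = ∫ H dμ`, Fubini, `integral_map`). [folklore] -/
theorem integral_sq_sub_le_of_split {μ : Measure X} [IsProbabilityMeasure μ] {π : Measure Y}
    [IsProbabilityMeasure π] {unsh : X × Y → Y} (hunsh : Measurable unsh)
    {g : Y → ℝ} (hg : Measurable g) {M : ℝ} (hM : ∀ v, |g v| ≤ M)
    {E : Type*} [Fintype E] {c : E → Y → ℝ} (hc : ∀ e, Measurable (c e)) {Mc : E → ℝ}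
    (hMc : ∀ e v, |c e v| ≤ Mc e)
    {H : X → ℝ} (hHdef : ∀ x, H x = ∫ w, g (unsh (x, w)) ∂π)
    {R : E → X → ℝ} (hRdef : ∀ e x, R e x = ∫ w, (g (unsh (x, w)) - c e (unsh (x, w))) ^ 2 ∂π)
    {A : ℝ} (hES : ∀ x : X, ∫ w, (g (unsh (x, w)) - H x) ^ 2 ∂π ≤ 2 * ∑ e, R e x)
    (hH : ∫ x, (H x - ∫ x', H x' ∂μ) ^ 2 ∂μ ≤ A * ∑ e, ∫ x, R e x ∂μ) :
    ∫ ω, (g ω.2 - ∫ ω', g ω'.2 ∂((μ.prod π).map fun ω => (ω.1, unsh ω))) ^ 2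
        ∂((μ.prod π).map fun ω => (ω.1, unsh ω)) ≤
      (4 + 2 * A) * ∑ e, ∫ ω, (g ω.2 - c e ω.2) ^ 2 ∂((μ.prod π).map fun ω => (ω.1, unsh ω)) := by
  have hΨ : Measurable fun ω : X × Y => (ω.1, unsh ω) := measurable_fst.prodMk hunsh
  have hgu : Measurable fun ω : X × Y => g (unsh ω) := hg.comp hunsh
  have hcu : ∀ e, Measurable fun ω : X × Y => c e (unsh ω) := fun e => (hc e).comp hunsh
  -- transfer of integrals to the honest product
  have htr : ∀ {φ : X × Y → ℝ}, Measurable φ →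
      ∫ ω, φ ω ∂((μ.prod π).map fun ω => (ω.1, unsh ω)) = ∫ ω, φ (ω.1, unsh ω) ∂(μ.prod π) :=
    fun hφ => integral_map hΨ.aemeasurable hφ.aestronglyMeasurable
  -- measurability and boundedness of `H` and `R e`
  have hHm : Measurable H := by
    have : H = fun x => ∫ w, g (unsh (x, w)) ∂π := funext hHdef
    rw [this]
    exact (hgu.stronglyMeasurable.integral_prod_right' (ν := π)).measurable
  have hHM : ∀ x, |H x| ≤ M := fun x => by
    rw [hHdef]
    exact abs_integral_le_of_abs_le fun w => hM _
  have hRm : ∀ e, Measurable (R e) := fun e => by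
    have : R e = fun x => ∫ w, (g (unsh (x, w)) - c e (unsh (x, w))) ^ 2 ∂π := funext (hRdef e)
    rw [this]
    exact (((hgu.sub (hcu e)).pow_const 2).stronglyMeasurable.integral_prod_right'
      (ν := π)).measurable
  have hRM : ∀ e x, |R e x| ≤ (M + Mc e) ^ 2 := fun e x => by
    rw [hRdef]
    exact abs_integral_le_of_abs_le fun w => abs_sq_sub_le (hM _) (hMc e _)
  have hRi : ∀ e, Integrable (R e) μ := fun e => integrable_of_abs_le (hRm e) (hRM e)
  -- the mean
  set m : ℝ := ∫ ω', g ω'.2 ∂((μ.prod π).map fun ω => (ω.1, unsh ω)) with hm_def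
  have hgi : Integrable (fun ω : X × Y => g (unsh ω)) (μ.prod π) :=
    integrable_of_abs_le hgu fun ω => hM _
  have hm : m = ∫ x, H x ∂μ := by
    rw [hm_def, htr (φ := fun ω => g ω.2) (hg.comp measurable_snd)]
    change ∫ ω, (fun ω : X × Y => g (unsh ω)) ω ∂(μ.prod π) = _
    rw [integral_prod (fun ω : X × Y => g (unsh ω)) hgi]
    exact integral_congr_ae (ae_of_all _ fun x => (hHdef x).symm)
  have hmM : |m| ≤ M := by
    rw [hm]; exact abs_integral_le_of_abs_le hHM
  -- left-hand side on the product, then Fubini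
  have hL1 : ∫ ω, (g ω.2 - m) ^ 2 ∂((μ.prod π).map fun ω => (ω.1, unsh ω)) =
      ∫ x, ∫ w, (g (unsh (x, w)) - m) ^ 2 ∂π ∂μ := by
    rw [htr (φ := fun ω => (g ω.2 - m) ^ 2) (((hg.comp measurable_snd).sub measurable_const).pow_const 2)]
    change ∫ ω, (fun ω : X × Y => (g (unsh ω) - m) ^ 2) ω ∂(μ.prod π) = _
    rw [integral_prod (fun ω : X × Y => (g (unsh ω) - m) ^ 2)
      (integrable_of_abs_le ((hgu.sub measurable_const).pow_const 2)
        fun ω => abs_sq_sub_le (hM _) hmM)]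
  -- right-hand side on the product, then Fubini
  have hR1 : ∀ e, ∫ ω, (g ω.2 - c e ω.2) ^ 2 ∂((μ.prod π).map fun ω => (ω.1, unsh ω)) =
      ∫ x, R e x ∂μ := fun e => by
    rw [htr (φ := fun ω => (g ω.2 - c e ω.2) ^ 2)
      (((hg.comp measurable_snd).sub ((hc e).comp measurable_snd)).pow_const 2)]
    change ∫ ω, (fun ω : X × Y => (g (unsh ω) - c e (unsh ω)) ^ 2) ω ∂(μ.prod π) = _
    rw [integral_prod (fun ω : X × Y => (g (unsh ω) - c e (unsh ω)) ^ 2)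
      (integrable_of_abs_le ((hgu.sub (hcu e)).pow_const 2)
        fun ω => abs_sq_sub_le (hM _) (hMc e _))]
    exact integral_congr_ae (ae_of_all _ fun x => (hRdef e x).symm)
  -- fibrewise estimate
  have hfib : ∀ x, ∫ w, (g (unsh (x, w)) - m) ^ 2 ∂π ≤ 4 * ∑ e, R e x + 2 * (H x - m) ^ 2 := by
    intro x
    have hi1 : Integrable (fun w => (g (unsh (x, w)) - H x) ^ 2) π :=
      integrable_of_abs_le (((hg.comp (hunsh.comp measurable_prodMk_left)).sub
        measurable_const).pow_const 2) fun w => abs_sq_sub_le (hM _) (hHM x)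
    have hi2 : Integrable (fun _ : Y => (H x - m) ^ 2) π := integrable_const _
    calc ∫ w, (g (unsh (x, w)) - m) ^ 2 ∂π
        ≤ ∫ w, (2 * (g (unsh (x, w)) - H x) ^ 2 + 2 * (H x - m) ^ 2) ∂π :=
          integral_mono_of_nonneg (ae_of_all _ fun w => sq_nonneg _)
            ((hi1.const_mul 2).add (hi2.const_mul 2))
            (ae_of_all _ fun w => sq_sub_le_two_mul_add' (g (unsh (x, w))) m (H x))
      _ = 2 * ∫ w, (g (unsh (x, w)) - H x) ^ 2 ∂π + 2 * (H x - m) ^ 2 := by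
          rw [integral_add (hi1.const_mul 2) (hi2.const_mul 2), integral_const_mul,
            integral_const_mul, integral_const, probReal_univ, one_smul]
      _ ≤ 2 * (2 * ∑ e, R e x) + 2 * (H x - m) ^ 2 := by
          have := hES x
          nlinarith
      _ = 4 * ∑ e, R e x + 2 * (H x - m) ^ 2 := by ring
  -- integrate the fibrewise estimate
  have hsumi : Integrable (fun x => ∑ e, R e x) μ := integrable_finsetSum _ fun e _ => hRi e
  have hHi2 : Integrable (fun x => (H x - m) ^ 2) μ :=
    integrable_of_abs_le ((hHm.sub measurable_const).pow_const 2) fun x => abs_sq_sub_le (hHM x) hmM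
  have hint : ∫ x, ∫ w, (g (unsh (x, w)) - m) ^ 2 ∂π ∂μ ≤
      4 * ∑ e, ∫ x, R e x ∂μ + 2 * ∫ x, (H x - m) ^ 2 ∂μ := by
    calc ∫ x, ∫ w, (g (unsh (x, w)) - m) ^ 2 ∂π ∂μ
        ≤ ∫ x, (4 * ∑ e, R e x + 2 * (H x - m) ^ 2) ∂μ :=
          integral_mono_of_nonneg (ae_of_all _ fun x => integral_nonneg fun w => sq_nonneg _)
            ((hsumi.const_mul 4).add (hHi2.const_mul 2)) (ae_of_all _ hfib)
      _ = 4 * ∑ e, ∫ x, R e x ∂μ + 2 * ∫ x, (H x - m) ^ 2 ∂μ := by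
          rw [integral_add (hsumi.const_mul 4) (hHi2.const_mul 2), integral_const_mul,
            integral_const_mul, integral_finsetSum _ fun e _ => hRi e]
  -- assemble
  have hsum0 : 0 ≤ ∑ e, ∫ x, R e x ∂μ :=
    Finset.sum_nonneg fun e _ => integral_nonneg fun x => by
      rw [hRdef]; exact integral_nonneg fun w => sq_nonneg _
  rw [hL1, Finset.mul_sum]
  simp_rw [hR1]
  rw [← Finset.mul_sum]
  rw [hm] at hint ⊢
  have hH' := hH
  nlinarith [hint, hH', hsum0]

end Abstract

/-! ### The torus: the unshear is coordinatewise -/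

/-- The one-level unshear `(U, w) ↦ e ↦ w_e · h_e(U)` acts coordinatewise: updating the noise
coordinate `e` updates the coordinate `e` of the block field. [folklore] -/
theorem unshear_update {E X G : Type*} [DecidableEq E] [Mul G] (h : X → E → G) (U : X)
    (w : E → G) (e : E) (y : G) :
    (fun e' => Function.update w e y e' * h U e') =
      Function.update (fun e' => w e' * h U e') e (y * h U e) := by
  funext e'
  by_cases he : e' = e
  · subst he; simp
  · simp [Function.update_of_ne he]

end OneLevelNecessity

/-! ### The registered riders -/

/-- Rider OLb `heatBathSensitivity_le`: **the heat-bath form of the posterior-mean function is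
dominated by the coarse single-coordinate residuals** — rider G1b
(`stub_heatBathSensitivity_of`) with its two hypotheses discharged by the landed riders N5
(`stub_tiltedShift_sq_le`, one-coordinate Holley–Stroock sensitivity) and N3
(`stub_straightPath_unique`, uniqueness of the coarse straight path through a fine link): for every
compact `G`, `r`, real `β`, block size `B ≥ 1` and pin strength `s` there is `K` such that for
every side, bounded measurable `g` and coordinate-blind bounded measurable `c_e`,
`Σ_ℓ ∫∫ (H(U) − H(U[ℓ↦y]))² dν_ℓ^U dμ ≤ K Σ_e ∫∫ (g − c_e)²(w·h(U)) dπ dμ`, `H(U) = ∫ g(w·h(U)) dπ(w)`.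
[folklore] -/
theorem heatBathSensitivity_le :
        ∀ (G : Type) [Group G] [TopologicalSpace G] [IsTopologicalGroup G] [CompactSpace G]
      [MeasurableSpace G] [BorelSpace G] (r : LatticeRep G) (β : ℝ) (B : ℕ) [NeZero B] (s : ℝ), ∃ K : ℝ, ∀ (S : ℕ)
      (g : GaugeConfig 4 (BalabanAveraging.blockSide (2 * S + 1) B) G → ℝ), Measurable g → (∃ M : ℝ, ∀ V, |g V| ≤ M) →
      ∀ (c : Edge 4 (BalabanAveraging.blockSide (2 * S + 1) B) → GaugeConfig 4 (BalabanAveraging.blockSide (2 * S + 1) B) G → ℝ),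
      (∀ e, Measurable (c e)) → (∀ e, ∃ M : ℝ, ∀ V, |c e V| ≤ M) →
      (∀ e V y, c e (Function.update V e y) = c e V) →
      ∑ ℓ : Edge 4 (2 * S + 1), ∫ U, ∫ y,
          ((∫ w, g (fun e => w e * BalabanAveraging.link (2 * S + 1) B (BalabanAveraging.BlockMean.rep 0) U e)
              ∂Measure.pi (fun _ : Edge 4 (BalabanAveraging.blockSide (2 * S + 1) B) => (haarProbability G).tilted fun w : G => s * (r.ρ w).trace.re)) -
            (∫ w, g (fun e => w e * BalabanAveraging.link (2 * S + 1) B (BalabanAveraging.BlockMean.rep 0) (Function.update U ℓ y) e)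
              ∂Measure.pi (fun _ : Edge 4 (BalabanAveraging.blockSide (2 * S + 1) B) => (haarProbability G).tilted fun w : G => s * (r.ρ w).trace.re))) ^ 2
        ∂((haarProbability G).tilted (fun g' => -β * wilsonAction r.ρ (Function.update U ℓ g')))
        ∂(wilsonMeasure r.ρ β : Measure (GaugeConfig 4 (2 * S + 1) G)) ≤
      K * ∑ e : Edge 4 (BalabanAveraging.blockSide (2 * S + 1) B), ∫ U, ∫ w,
          (g (fun e' => w e' * BalabanAveraging.link (2 * S + 1) B (BalabanAveraging.BlockMean.rep 0) U e') - c e (fun e' => w e' * BalabanAveraging.link (2 * S + 1) B (BalabanAveraging.BlockMean.rep 0) U e')) ^ 2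
        ∂Measure.pi (fun _ : Edge 4 (BalabanAveraging.blockSide (2 * S + 1) B) => (haarProbability G).tilted fun w : G => s * (r.ρ w).trace.re)
        ∂(wilsonMeasure r.ρ β : Measure (GaugeConfig 4 (2 * S + 1) G)) :=
  stub_heatBathSensitivity_of stub_tiltedShift_sq_le stub_straightPath_unique

/-- Rider OL `oneLevel_variance_le`: **the one-level necessity inequality — UP for the Wilson
measure implies the annealed coarse-coordinate variance bound for the one-level joint law.**  For
every compact `G`, `r`, real `β` and `C` with the uniform heat-bath Poincaré inequality
`Var_μ F ≤ C·HB(F)` of `μ = μ_{β,S}` (all `S`, all bounded measurable `F`), every block size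
`B ≥ 1` and pin strength `s`, there is `K` (namely `4 + 2|C|·|K'|`, `K'` from
`heatBathSensitivity_le`) such that for every side `2S+1`, the one-level joint law `P` of the fine
field and its smeared block field, every bounded measurable `g` of the block field and every
family of bounded measurable `c_e` with `c_e(V[e↦y]) = c_e(V)`:
`∫ (g(V) − ∫ g dP)² dP ≤ K Σ_e ∫ (g(V) − c_e(V))² dP`.
Proof: noise representation `P = (μ ⊗ π).map unshear` (N1, `stub_oneLevelLaw_eq_map`), the abstract
split `OneLevelNecessity.integral_sq_sub_le_of_split` with the fibrewise Efron–Stein bound (N4,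
`stub_productVariance_le`; the approximants `c_e ∘ unshear(U, ·)` are blind to the noise
coordinate `e` by `OneLevelNecessity.unshear_update`) and `Var_μ(H) ≤ |C|·HB(H) ≤ |C|·|K'|·Σ_e ∫R_e`
(UP applied to the bounded measurable `H`, `ProbabilityTheory.variance_eq_integral`, then OLb).
[folklore] -/
theorem oneLevel_variance_le :
        ∀ (G : Type) [Group G] [TopologicalSpace G] [IsTopologicalGroup G] [CompactSpace G]
      [MeasurableSpace G] [BorelSpace G] (r : LatticeRep G) (β C : ℝ),
      (∀ (S : ℕ) (F : GaugeConfig 4 (2 * S + 1) G → ℝ), Measurable F → (∃ M : ℝ, ∀ U, |F U| ≤ M) →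
        variance F (wilsonMeasure r.ρ β : Measure (GaugeConfig 4 (2 * S + 1) G)) ≤
          C * ∑ ℓ : Edge 4 (2 * S + 1), ∫ U, ∫ g, (F U - F (Function.update U ℓ g)) ^ 2
            ∂((haarProbability G).tilted (fun g' => -β * wilsonAction r.ρ (Function.update U ℓ g')))
            ∂(wilsonMeasure r.ρ β : Measure (GaugeConfig 4 (2 * S + 1) G))) →
      ∀ (B : ℕ) [NeZero B] (s : ℝ), ∃ K : ℝ, ∀ (S : ℕ)
        (P : Measure (GaugeConfig 4 (2 * S + 1) G × GaugeConfig 4 (BalabanAveraging.blockSide (2 * S + 1) B) G)),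
        P = ((wilsonMeasure r.ρ β : Measure (GaugeConfig 4 (2 * S + 1) G)).prod
          (Measure.pi fun _ : Edge 4 (BalabanAveraging.blockSide (2 * S + 1) B) => haarProbability G)).tilted
          (fun ω => ∑ e : Edge 4 (BalabanAveraging.blockSide (2 * S + 1) B),
            s * (r.ρ (ω.2 e * (BalabanAveraging.link (2 * S + 1) B
              (BalabanAveraging.BlockMean.rep 0) ω.1 e)⁻¹)).trace.re) →
        ∀ (g : GaugeConfig 4 (BalabanAveraging.blockSide (2 * S + 1) B) G → ℝ), Measurable g →
        (∃ M : ℝ, ∀ V, |g V| ≤ M) →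
        ∀ (c : Edge 4 (BalabanAveraging.blockSide (2 * S + 1) B) →
          GaugeConfig 4 (BalabanAveraging.blockSide (2 * S + 1) B) G → ℝ),
        (∀ e, Measurable (c e)) → (∀ e, ∃ M : ℝ, ∀ V, |c e V| ≤ M) →
        (∀ e V y, c e (Function.update V e y) = c e V) →
        ∫ ω, (g ω.2 - ∫ ω', g ω'.2 ∂P) ^ 2 ∂P ≤
          K * ∑ e : Edge 4 (BalabanAveraging.blockSide (2 * S + 1) B), ∫ ω, (g ω.2 - c e ω.2) ^ 2 ∂P := by
  intro G _ _ _ _ _ _ r β C hUP B _ s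
  obtain ⟨K', hK'⟩ := heatBathSensitivity_le G r β B s
  refine ⟨4 + 2 * (|C| * |K'|), ?_⟩
  intro S P hP g hg hgb c hc hcb hcu
  obtain ⟨M, hM⟩ := hgb
  choose Mc hMc using hcb
  haveI : SecondCountableTopology G :=
    (r.continuous.isClosedEmbedding r.injective).isEmbedding.secondCountableTopology
  haveI := isProbabilityMeasure_wilsonMeasure (d := 4) (L := 2 * S + 1) (G := G) r.ρ r.continuous β
  obtain ⟨hν, hlaw⟩ := stub_oneLevelLaw_eq_map G r β B s S
  haveI := hν
  -- notation
  set μ : Measure (GaugeConfig 4 (2 * S + 1) G) := wilsonMeasure r.ρ β with hμ_def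
  set ν : Measure G := (haarProbability G).tilted fun w : G => s * (r.ρ w).trace.re with hν_def
  set h : GaugeConfig 4 (2 * S + 1) G → Edge 4 (BalabanAveraging.blockSide (2 * S + 1) B) → G :=
    fun U e => BalabanAveraging.link (2 * S + 1) B (BalabanAveraging.BlockMean.rep 0) U e with hh_def
  set π : Measure (GaugeConfig 4 (BalabanAveraging.blockSide (2 * S + 1) B) G) :=
    Measure.pi fun _ : Edge 4 (BalabanAveraging.blockSide (2 * S + 1) B) => ν with hπ_def
  set unsh : GaugeConfig 4 (2 * S + 1) G × GaugeConfig 4 (BalabanAveraging.blockSide (2 * S + 1) B) G →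
      GaugeConfig 4 (BalabanAveraging.blockSide (2 * S + 1) B) G :=
    fun ω e => ω.2 e * h ω.1 e with hunsh_def
  have hunsh : Measurable unsh := OneLevelLaw.measurable_unskew S B
  -- the posterior-mean function and the residuals
  set H : GaugeConfig 4 (2 * S + 1) G → ℝ := fun U => ∫ w, g (unsh (U, w)) ∂π with hH_def
  set R : Edge 4 (BalabanAveraging.blockSide (2 * S + 1) B) → GaugeConfig 4 (2 * S + 1) G → ℝ :=
    fun e U => ∫ w, (g (unsh (U, w)) - c e (unsh (U, w))) ^ 2 ∂π with hR_def
  -- (1) fibrewise Efron–Stein with the coordinate-blind approximants `c_e ∘ unsh(U, ·)`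
  have hES : ∀ U : GaugeConfig 4 (2 * S + 1) G,
      ∫ w, (g (unsh (U, w)) - H U) ^ 2 ∂π ≤ 2 * ∑ e, R e U := by
    intro U
    have hgm : Measurable fun w : GaugeConfig 4 (BalabanAveraging.blockSide (2 * S + 1) B) G =>
        g (unsh (U, w)) := hg.comp (hunsh.comp measurable_prodMk_left)
    have hcm : ∀ e, Measurable fun w : GaugeConfig 4 (BalabanAveraging.blockSide (2 * S + 1) B) G =>
        c e (unsh (U, w)) := fun e => (hc e).comp (hunsh.comp measurable_prodMk_left)
    have hcfree : ∀ e w y, c e (unsh (U, Function.update w e y)) = c e (unsh (U, w)) := by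
      intro e w y
      change c e (fun e' => Function.update w e y e' * h U e') = c e (fun e' => w e' * h U e')
      rw [OneLevelNecessity.unshear_update h U w e y, hcu]
    exact stub_productVariance_le (Edge 4 (BalabanAveraging.blockSide (2 * S + 1) B)) (fun _ => G)
      (fun _ => ν) (fun w => g (unsh (U, w))) hgm ⟨M, fun w => hM _⟩
      (fun e w => c e (unsh (U, w))) hcm (fun e => ⟨Mc e, fun w => hMc e _⟩) hcfree
  -- (2) UP for `H`, then OLb
  have hHm : Measurable H :=
    ((hg.comp hunsh).stronglyMeasurable.integral_prod_right' (ν := π)).measurable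
  have hHM : ∀ U, |H U| ≤ M := fun U =>
    OneLevelNecessity.abs_integral_le_of_abs_le fun w => hM _
  have hvar := hUP S H hHm ⟨M, hHM⟩
  have hhb := hK' S g hg ⟨M, hM⟩ c hc (fun e => ⟨Mc e, hMc e⟩) hcu
  have hsum0 : 0 ≤ ∑ e, ∫ U, R e U ∂μ :=
    Finset.sum_nonneg fun e _ => integral_nonneg fun U => integral_nonneg fun w => sq_nonneg _
  have hHB0 : 0 ≤ ∑ ℓ : Edge 4 (2 * S + 1), ∫ U, ∫ y, (H U - H (Function.update U ℓ y)) ^ 2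
      ∂((haarProbability G).tilted (fun g' => -β * wilsonAction r.ρ (Function.update U ℓ g'))) ∂μ :=
    Finset.sum_nonneg fun ℓ _ => integral_nonneg fun U => integral_nonneg fun y => sq_nonneg _
  have hH : ∫ U, (H U - ∫ U', H U' ∂μ) ^ 2 ∂μ ≤ (|C| * |K'|) * ∑ e, ∫ U, R e U ∂μ := by
    rw [← variance_eq_integral hHm.aemeasurable]
    calc variance H μ
        ≤ C * ∑ ℓ : Edge 4 (2 * S + 1), ∫ U, ∫ y, (H U - H (Function.update U ℓ y)) ^ 2
            ∂((haarProbability G).tilted (fun g' => -β * wilsonAction r.ρ (Function.update U ℓ g'))) ∂μ := hvar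
      _ ≤ |C| * ∑ ℓ : Edge 4 (2 * S + 1), ∫ U, ∫ y, (H U - H (Function.update U ℓ y)) ^ 2
            ∂((haarProbability G).tilted (fun g' => -β * wilsonAction r.ρ (Function.update U ℓ g'))) ∂μ :=
          mul_le_mul_of_nonneg_right (le_abs_self C) hHB0
      _ ≤ |C| * (K' * ∑ e, ∫ U, R e U ∂μ) := mul_le_mul_of_nonneg_left hhb (abs_nonneg C)
      _ ≤ |C| * (|K'| * ∑ e, ∫ U, R e U ∂μ) :=
          mul_le_mul_of_nonneg_left (mul_le_mul_of_nonneg_right (le_abs_self K') hsum0) (abs_nonneg C)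
      _ = (|C| * |K'|) * ∑ e, ∫ U, R e U ∂μ := by ring
  -- (3) the abstract split
  have key := OneLevelNecessity.integral_sq_sub_le_of_split (μ := μ) (π := π) hunsh hg hM hc hMc
    (H := H) (fun U => rfl) (R := R) (fun e U => rfl) (A := |C| * |K'|) hES hH
  rw [hP, hlaw]
  exact key

end Summit.QuantumFields.YangMills.Theorems.SusceptibilityToPoincare.RgVarianceCascade

end
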